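import Literature.IUT.HodgeArakelov.ThetaEnvDataRecordAutSaturatedOfGalois
import Literature.IUT.HodgeArakelov.EtaleThetaDataOfSettingRootHypCore

/-!
# [IUTchII] Prop 3.4 (i) at the GENUINE data — statement of record of node IUTchII:Prop3.4(i) with BOTH open binders in
# print's own currency: (P4) `hroot` := the six [EtTh] §1–§2 inputs (E1′)(E3)(UNIT)(SIGN)(LABEL) + Prop 1.5 (ii), (P3) := `hgal`

S. Mochizuki, *Inter-universal Teichmüller theory II*, kurims manuscript (Dec. 2020): Prop 3.4 (i) pp. 91–92
[cite: Mochizuki2012, Prop 3.4 (i) p.91]; Prop 3.1 (i) p. 87, (ii) p. 88; Prop 1.4 p. 27; Cor 1.11 (b) p. 49.  Claim key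
DISPUTED (D-0012).  Refereed inputs BY NAME ([EtTh] = S. Mochizuki, Publ. RIMS **45** (2009)): Cor. 2.18 (i) p. 60 (= FACT
F-0620), Prop. 2.4 p. 38, Thm. 1.6 (i)–(iii) p. 24, Thm. 1.10 (i) p. 31, Prop. 1.4 (ii) p. 20, Prop. 1.5 (ii) p. 22, Cor. 2.19 (iii)
p. 65; [AbsTopIII] Cor. 1.10 pp. 41–44.  abc-iut cell, layer L6, WAVE-5 seat abc-iut-w5-d169 (gen 4; holder of node
IUTchII:Prop3.4(i) / `plan/L6/SUBDAG-IUTchII-Prop-31-33-34.md`); GAP-LEDGER rows G-w5d169-2 (reduced by abc-iut-w4-d041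
p436508/p436936/p438115 and abc-iut-w6-d002 p438240/p438524 to the binders below), G-w5d169-3 (reduced to `hgal` by
abc-iut-w4-d007 p434937; census of record 2026-08-26: provenance-class input).

PROOF-ONLY assembly (no definition, no `Prop`-valued fact, nothing restated): this seat's
`EtaleLevels.prop34i_multiradiallyDefined_saturated_ofGalois` (p437226) with the root hypothesis (P4) `hroot` SUPPLIED by
abc-iut-w6-d002's `EtaleThetaDataOfSetting.rootHyp_of_forall_extends_core_deltaStable` (p438524; through abc-iut-w4-d041's
`rootHyp_of_transport_eq_conj'`, p436936) from, per `α ∈ Aut_top(Π^tp_X̲̲)`: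
(E1′) an extension `γ ∈ Aut_top(Π^tp_X)` of `α` with `Thm16i γ` and `γ(Δ^tp_X) = Δ^tp_X` ([EtTh] Prop. 2.4 / Thm. 1.6 (i) shape;
the companion (E2) is then abc-iut-w5-d072's CONSTRUCTED `thetaCompanionOfAut`, Thm. 1.6 (ii)); (E3) the Thm. 1.6 (iii) CORE
IDENTITY `transport c h η̈^Θ = k · conj_σ η̈^Θ`; (UNIT) `k ∈ {1, m}` (Thm. 1.10 (i) «up to ±1»); (LABEL) `σ ∈ Π^tp_X̲̲ · Π^tp_Ÿ`
(zero label); together with the global (SIGN) `∃ ι₂ ∈ Π^tp_X̲̲, conj_{ι₂} η̈^Θ = m · η̈^Θ`, `m ∈ κ(O^×_{K̈})` (Prop. 1.4 (ii)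
«Θ̈(−Ü) = −Θ̈(Ü)») and [EtTh] Prop. 1.5 (ii) `h15ii` (units classes are `Π^tp_X`-invariant).
* **`EtaleLevels.prop34i_multiradiallyDefined_saturated_ofCore`** — [IUTchII] Prop 3.4 (i) MULTIRADIALITY OF SPLIT THETA
  MONOIDS AT THE GENUINE FUNCTOR (saturated index set, constants `ℚ̄_pˣ ⊇ O` through `ε`, genuine Kummer map), residual BY
  NAME exactly: F-0620 (FACT) · `hq` (origin clause R3) · `hO'` (`IsEtThOrigin`) · `h15ii` ([EtTh] Prop. 1.5 (ii)) · `hsign`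
  · `hE` = (E1′) ∧ (E3) ∧ (UNIT) ∧ (LABEL) per `α` (all [EtTh] §1–§2, L2-side) · `hgal` = (HGAL) ∧ (HCYC) ([AbsTopIII] Cor. 1.10
  at the strictly-Belyi instance, G-w5d169-3) · the standing record/tower inputs.
* **`EtaleLevels.exists_coeff_prop34i_multiradiallyDefined_saturated_ofCore`** — the same with the coefficient datum `c`
  DISCHARGED from the tower (abc-iut-w4-d007's `exists_cyclotomeCoefficients_of_cyclotomeTower`, under `hO'` + `hΔ`).
Nothing here asserts anything of [IUTchII] or [EtTh]; no side taken on [IUTchIII] Cor 3.12; typed ≠ proved for the binders.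
-/

noncomputable section

open Topology

namespace Literature.IUT.HodgeArakelov

open Literature.AnabelianGeometry.EtaleTheta Literature.AnabelianGeometry.SemiGraphs
open CohomologySystemOfContH1 EtaleThetaDataOfSetting TemperedThetaMonoids
open scoped Literature.AnabelianGeometry.EtaleTheta

namespace EtaleLevels

variable {p : ℕ} [Fact p.Prime] {D : Literature.AnabelianGeometry.EtaleTheta.ThetaSetting p}
  {E : D.EtaleThetaData} {l : ℕ} (C : E.DoubleUnderline l) (hC : D.Compat) (hS : D.Sec2Hyps)
  (hl : l.Prime) (hp2 : p ≠ 2) (hpl : p ≠ l) (hζ : ∃ ζ : D.K, IsPrimitiveRoot ζ (4 * l))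
  (mods : ∀ M : ℕ+, D.CyclotomeMod l M)
  (f : contCocycles D.toTheta D.DeltaTheta C.GtpYdduu) (hf : f ∈ C.rootCocycles hC)
  (hmods : ∀ (M M' : ℕ+) (h : (M : ℕ) ∣ (M' : ℕ)) (x : D.lDeltaTheta l),
    MuN.red p M M' h ((mods M').red x) = (mods M).red x)
  (h15 : Literature.AnabelianGeometry.EtaleTheta.ThetaSetting.Prop15iii E hC) (L : C.CuspLabels)
  (hZ : ∀ M : ℕ+, Nonempty (ModelCyclotomes.lDeltaQuot (C.rigidData (mods M) hC hS h15 L) ≃*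
    Literature.IUT.HodgeTheaters.ZHat))
  (hcharY : EtaleThetaDataOfSetting.PiYddCharacteristic C)
  (hlim : Function.Bijective (rigidLimHom C hC hS hl hp2 hpl hζ mods f hf hmods h15 L hZ))
  [(EtaleThetaDataOfSetting.PiYdd C).Normal]
  (hq : IsQuotientMap D.toTheta) {N : ℕ+} (μ : D.CyclotomeMod l N)
  (R : RigidData.{0} N l) (hR : R = C.rigidData μ hC hS h15 L) (h218i : R.Cor218_i)
  (h15ii : ThetaSetting.Prop15ii E.toKummerData hC) {m : D.H1 D.GtpYdd} (hm : m ∈ E.kumUnitsYdd)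
  (hsign : ∃ ι₂ : Pi C, haveI := hC.GtpYdd_normal
    ContH1.conj D.toTheta D.DeltaTheta (ι₂ : D.PiTemp) E.etaDd = m * E.etaDd)
  (hE : ∀ α : (Pi C) ≃ₜ* (Pi C), ∃ (γ : D.PiTemp ≃ₜ* D.PiTemp)
    (_ : ∀ x : Pi C, ((α x : Pi C) : D.PiTemp) = γ (x : D.PiTemp)) (h : ThetaSetting.Thm16i γ)
    (hΔ : D.DeltaTemp.map γ.toMulEquiv.toMonoidHom = D.DeltaTemp) (k : D.H1 D.GtpYdd) (σ : D.PiTemp),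
    haveI := hC.GtpYdd_normal
    ThetaSetting.transport (D.thetaCompanionOfAut γ hΔ hq) h E.etaDd =
        k * ContH1.conj D.toTheta D.DeltaTheta σ E.etaDd ∧
      (k = 1 ∨ k = m) ∧ ∃ (τ₀ : Pi C) (y : D.PiTemp), y ∈ D.GtpYdd ∧ σ = (τ₀ : D.PiTemp) * y)
  (ι₀ : (Pi C) ≃ₜ* (Pi C))
  {Es : Set ℕ+} (τw : D.CyclotomeTower l Es)
  (O : Submonoid (PadicAlgCl p)ˣ)
  (hO : ∀ (σ : GQp p) (u : (PadicAlgCl p)ˣ), u ∈ O → Units.map (σ : PadicAlgCl p →* PadicAlgCl p) u ∈ O)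
  (hO' : D.IsEtThOrigin)
  (hgal : ∀ α : (Pi C) ≃ₜ* (Pi C), ∃ τ : GQp p,
    (∀ x : Pi C, aug C (α x) = τ * aug C x * τ⁻¹) ∧
    (∀ (M : ℕ+) (z w : D.lDeltaTheta l),
      ((rangeAutOfCor218i C μ hq hC hS h15 L R hR h218i α
          ⟨(z : D.GtpTheta), lDeltaTheta_le_phiRange C z.2⟩ : phiRange C) : D.GtpTheta) = (w : D.GtpTheta) →
        (τw.modAll M).red w = galMuN p M τ ((τw.modAll M).red z)))

/-- **[IUTchII] Prop 3.4 (i) — MULTIRADIALITY OF SPLIT THETA MONOIDS AT THE GENUINE FUNCTOR, both open binders in print's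
currency**: (P1) := {F-0620, `hq`}; (P2) none (saturated index set); (P3) := `hgal` = (HGAL) ∧ (HCYC); (P4) := `hroot` FROM
`h15ii` · `hsign` · `hE` = (E1′) extension with `Thm16i` and `γ(Δ^tp_X) = Δ^tp_X` ∧ (E3) core identity ∧ (UNIT) ∧ (LABEL)
(abc-iut-w6-d002's `rootHyp_of_forall_extends_core_deltaStable`). [cite: Mochizuki2012, Prop 3.4 (i) p.92] -/
theorem prop34i_multiradiallyDefined_saturated_ofCore
    (c : CyclotomeCoefficients (phi C) (D.lDeltaTheta l) (PadicAlgCl p)ˣ)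
    (hlev : ∀ (ζ : cyclotome (PadicAlgCl p)ˣ) (M : ℕ+),
      (((τw.modAll M).red (c.hom ζ) : MuN p M) : (PadicAlgCl p)ˣ) = (ζ : ℕ+ → (PadicAlgCl p)ˣ) M)
    {η : (C.thetaEnvData μ hC hS).PiYdd → MuN p N} (hη : η ∈ (C.thetaEnvData μ hC hS).thetaCocycles)
    (Γ : Type) [Group Γ] :
    ((ex18iii (ThetaSetting.ofDoubleUnderline C μ hC hS hl hp2 hpl hζ hη) Γ).toDagger
      (TemperedThetaMonoids.prop34iRadialFunctor
        (thetaEnvTransportS C hC hS hl hp2 hpl hζ mods f hf hmods h15 L hZ hcharY hlim hq μ R hR h218i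
          (h1LimKummerOn (phi C) (D.lDeltaTheta l) (PiYdd C) c (isOpen_stabilizer_units C)
            (finiteIndex_stabilizer_units C) O) ι₀
          (map_mrange_h1LimKummerOn_eq_of_galois C hq μ τw c hlev O hO hC hS h15 L R hR h218i hO' hgal)
          (image_toLim_theta_thetaEnvData_of_rootHyp C hC hS hl hp2 hpl hζ mods f hf hmods h15 L hZ hcharY hlim hq
            μ R hR h218i
            (rootHyp_of_forall_extends_core_deltaStable C hq μ hC hS h15 L R hR h218i h15ii hm hsign hE))
          (image_thetaInfty_thetaEnvData_of_rootHyp C hC hS hl hp2 hpl hζ mods f hf hmods h15 L hZ hcharY hlim hq μ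
            R hR h218i
            (rootHyp_of_forall_extends_core_deltaStable C hq μ hC hS h15 L R hR h218i h15ii hm hsign hE)) hη)
        Γ)).IsMultiradiallyDefined :=
  prop34i_multiradiallyDefined_saturated_ofGalois C hC hS hl hp2 hpl hζ mods f hf hmods h15 L hZ hcharY hlim hq μ R hR
    h218i (rootHyp_of_forall_extends_core_deltaStable C hq μ hC hS h15 L R hR h218i h15ii hm hsign hE) ι₀ τw O hO hO'
    hgal c hlev hη Γ

/-- **The same with the coefficient datum DISCHARGED** (`exists_cyclotomeCoefficients_of_cyclotomeTower` under `hO'` + `hΔ`):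
residual BY NAME {F-0620, `hq`, `hO'`, `hΔ`, `h15ii`, `hsign`, `hE`, `hgal`} plus the standing record/tower inputs.
[cite: Mochizuki2012, Prop 3.4 (i) p.92] -/
theorem exists_coeff_prop34i_multiradiallyDefined_saturated_ofCore
    (hΔ : IsCompact (D.DeltaTheta : Set D.GtpTheta))
    {η : (C.thetaEnvData μ hC hS).PiYdd → MuN p N} (hη : η ∈ (C.thetaEnvData μ hC hS).thetaCocycles)
    (Γ : Type) [Group Γ] :
    ∃ (c : CyclotomeCoefficients (phi C) (D.lDeltaTheta l) (PadicAlgCl p)ˣ)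
      (hlev : ∀ (ζ : cyclotome (PadicAlgCl p)ˣ) (M : ℕ+),
        (((τw.modAll M).red (c.hom ζ) : MuN p M) : (PadicAlgCl p)ˣ) = (ζ : ℕ+ → (PadicAlgCl p)ˣ) M),
      Function.Bijective c.hom ∧
      ((ex18iii (ThetaSetting.ofDoubleUnderline C μ hC hS hl hp2 hpl hζ hη) Γ).toDagger
        (TemperedThetaMonoids.prop34iRadialFunctor
          (thetaEnvTransportS C hC hS hl hp2 hpl hζ mods f hf hmods h15 L hZ hcharY hlim hq μ R hR h218i
            (h1LimKummerOn (phi C) (D.lDeltaTheta l) (PiYdd C) c (isOpen_stabilizer_units C)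
              (finiteIndex_stabilizer_units C) O) ι₀
            (map_mrange_h1LimKummerOn_eq_of_galois C hq μ τw c hlev O hO hC hS h15 L R hR h218i hO' hgal)
            (image_toLim_theta_thetaEnvData_of_rootHyp C hC hS hl hp2 hpl hζ mods f hf hmods h15 L hZ hcharY hlim hq
              μ R hR h218i
              (rootHyp_of_forall_extends_core_deltaStable C hq μ hC hS h15 L R hR h218i h15ii hm hsign hE))
            (image_thetaInfty_thetaEnvData_of_rootHyp C hC hS hl hp2 hpl hζ mods f hf hmods h15 L hZ hcharY hlim hq
              μ R hR h218i
              (rootHyp_of_forall_extends_core_deltaStable C hq μ hC hS h15 L R hR h218i h15ii hm hsign hE)) hη)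
          Γ)).IsMultiradiallyDefined :=
  exists_coeff_prop34i_multiradiallyDefined_saturated_ofGalois C hC hS hl hp2 hpl hζ mods f hf hmods h15 L hZ hcharY
    hlim hq μ R hR h218i (rootHyp_of_forall_extends_core_deltaStable C hq μ hC hS h15 L R hR h218i h15ii hm hsign hE) ι₀
    τw O hO hO' hgal hΔ hη Γ

end EtaleLevels

end Literature.IUT.HodgeArakelov

end
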